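import Summits.RiemannHypothesis.RiemannHypothesis.Theses.GroundBarta
import Summits.RiemannHypothesis.RiemannHypothesis.Theorems.WeilGroundStateGroundStatesConvergeToXiWeakLimitHarmonic
import Summits.RiemannHypothesis.RiemannHypothesis.Theorems.WeilGroundStateGroundStatesConvergeToXiExpClassHarmonic
import Summits.RiemannHypothesis.RiemannHypothesis.Theorems.WeilGroundStateGroundStatesConvergeToXiStubStrongClassPairing
import Summits.RiemannHypothesis.RiemannHypothesis.Theorems.WeilGroundStateGroundStatesConvergeToXiStubPhiIteratedDerivEnvelope
import Summits.RiemannHypothesis.RiemannHypothesis.Theorems.WeilGroundStateGroundStatesConvergeToXiStubHarmonicExtension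
import Summits.RiemannHypothesis.RiemannHypothesis.Theorems.GroundBartaGroundBartaFloorDefs
import Summits.RiemannHypothesis.RiemannHypothesis.Theorems.GroundBartaGroundBartaFloorRateDecay
import Summits.RiemannHypothesis.RiemannHypothesis.Theorems.GroundBartaGroundBartaFloorApproximants
import Summits.RiemannHypothesis.RiemannHypothesis.Theorems.GroundBartaGroundBartaFloorInnerCutoff
import Summits.RiemannHypothesis.RiemannHypothesis.Theorems.GroundBartaGroundBartaFloorInnerPairing
import Summits.RiemannHypothesis.RiemannHypothesis.Theorems.GroundBartaGroundBartaFloorInnerSplit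
import Summits.RiemannHypothesis.RiemannHypothesis.Theorems.GroundBartaGroundBartaFloorInnerArchBound
import Summits.RiemannHypothesis.RiemannHypothesis.Theorems.GroundBartaGroundBartaFloorBartaPrelim
import Literature.NumberTheory.LFunctions.WeilGroundState
import Literature.NumberTheory.LFunctions.WeilGroundEnergyProofs
import Literature.NumberTheory.LFunctions.WeilOddThetaVector
import Literature.NumberTheory.LFunctions.WeilThetaPhiMellin
import Literature.NumberTheory.LFunctions.DeBruijnPhiDecreasing
import Literature.Analysis.Calculus.SmoothCutoff

/-!
# Crux `GroundBarta.GroundBartaFloor` (stmt-RiemannHypothesis-18389) — line `inner-cutoff-strong-EL`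
# (part 1/3: the probe, the polar weight, the collar estimates)

Barta's floor for the FULL windowed Weil form, by the STRONG Euler–Lagrange identity of a ground
state against the INNER smooth cut-offs of Riemann's kernel.

Let the window `a > 0` carry a ground state `u` (operator-free: `IsWeilGroundState a u`) that is real
and `≥ 0` a.e. on `(-a, a)`; let `v ≥ 0` be its real representative (`u = v` a.e.).  For a collar
width `0 < η < a` let `θ_η` be a smooth even plateau cut-off, `θ_η = 1` on `[-(a-η), a-η]`,
`θ_η = 0` off `(-a, a)`, `0 ≤ θ_η ≤ 1`, `|θ_η'| ≤ D/η` (`stub_groundCutoff`).  Then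

* the INNER PROBE `h_η = Φ θ_η` is a Weil test supported in the window, so the strong Euler–Lagrange
  identity (`IsWeilGroundState.weilFunctional_eq_energy_mul`, in tree, RH-free) gives
  `W(v ⋆ h̃_η) = ε(a) ∫ v Φ θ_η`;
* HARMONIC SPLIT (`stub_groundHarmonicSplit`): `Φ̂ = ξ` vanishes on the zeros, so by the class
  explicit formula `W(v ⋆ h̃_η) = -W(v ⋆ κ̃_η)`, `κ_η = Φ(1 - θ_η) ≥ 0` the collar-plus-tail kernel;
* TERMWISE SIGNS for `f_η = v ⋆ κ̃_η ≥ 0` (smooth, exponential class: `stub_groundPairingClass`):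
  prime term `≥ 0`; polar term `= (∫ κ_η cosh(t/2)) · (∫ v · 2cosh(t/2)) ≤ ϖ_{a-η} · C(v)`
  (`stub_groundPolar`); archimedean term (Bombieri's form) `≤ K₀ (m (m S)^{1/2})^{1/2}` with
  `m = f_η(0) ≤ Φ(0) √(2η)` (Cauchy–Schwarz on the collar, `‖v‖₂ ≤ 1`) and `S = sup |f_η'| ≤ B/η`
  (`stub_groundArchBound`);
* `η → 0⁺`: `ε(a) ∫ vΦ ≥ -ϖ_a C(v)`, and `Φ(a) C(v) ≤ 2cosh(a/2) ∫ vΦ`, `∫ vΦ > 0` give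
  `ε(a) ≥ -e(a)`, `e(a) = 2ϖ_a cosh(a/2)/Φ(a) = groundBartaRate a → 0` (`stub_groundRateDecay`,
  LANDED in `GroundBartaGroundBartaFloorRateDecay`).

No outer cut-off, no window-continuity of `ε`, no minimising sequence is used.  The five stubs of
the line (`stub_groundCutoff`, `stub_groundPairingClass`, `stub_groundHarmonicSplit`,
`stub_groundPolar`, `stub_groundArchBound`) and the rate `stub_groundRateDecay` are LANDED in the
sibling `GroundBartaGroundBartaFloorInner*.lean` / `…RateDecay.lean` files; this file is the
sorry-free composition `GroundBartaFloor_of_innerCutoff`, a SECOND, independent proof of the crux (the first is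
prover A's outer-cutoff line, `Theorems/GroundBartaGroundBartaFloor*.lean` of 2026-08-18).
Prover B, speedrun unit `sr-gb-rung-b`.
-/

set_option linter.dupNamespace false

noncomputable section

open Set MeasureTheory Filter Complex
open scoped Real Topology ComplexConjugate

namespace Summit.RiemannHypothesis.RiemannHypothesis.Theorems.GroundBartaFloor

open Literature.NumberTheory.LFunctions
open Summit.RiemannHypothesis.RiemannHypothesis.Theorems.GroundStatesConvergeToXi

/-! The five stubs of the line are LANDED (prover B, `--as helper` on the item):
`stub_groundCutoff` (…InnerCutoff), `stub_groundPairingClass`, `stub_groundPolar` (…InnerPairing),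
`stub_groundHarmonicSplit` (…InnerSplit), `stub_groundArchBound` (…InnerArchBound); the rate
`stub_groundRateDecay` is prover −2's (…RateDecay). -/

/-! ## Riemann's kernel: spelling bridge, smoothness, derivative bound -/

/-- `(Φ : ℂ) = 2Ψ_ℂ(2·)` (bridge to the tree's spelling of Riemann's kernel). -/
theorem ic_ofReal_weilThetaPhi_eq :
    (fun t : ℝ => ((weilThetaPhi t : ℝ) : ℂ)) = fun t : ℝ => (2 : ℂ) * LagariasMontague.Psic (2 * t) := by
  funext t
  rw [weilThetaPhi_eq_two_mul_Psi]
  simp [LagariasMontague.Psic]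

/-- A uniform bound for `Φ'`. -/
theorem ic_exists_abs_deriv_weilThetaPhi_le : ∃ M : ℝ, 0 ≤ M ∧ ∀ t : ℝ, |deriv weilThetaPhi t| ≤ M := by
  obtain ⟨C, hC⟩ := stub_phi_iteratedDeriv_envelope 1
  refine ⟨max C 0, le_max_right _ _, fun t => ?_⟩
  have h := hC t
  rw [iteratedDeriv_one, ← ic_ofReal_weilThetaPhi_eq] at h
  have hd : deriv (fun t : ℝ => ((weilThetaPhi t : ℝ) : ℂ)) t = ((deriv weilThetaPhi t : ℝ) : ℂ) := by
    rw [deriv_weilThetaPhi]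
    exact ((hasDerivAt_weilThetaPhi t).ofReal_comp).deriv
  rw [hd, Complex.norm_real, Real.norm_eq_abs] at h
  refine h.trans ?_
  calc C * Real.exp (-(1 * |t|)) ≤ max C 0 * Real.exp (-(1 * |t|)) :=
        mul_le_mul_of_nonneg_right (le_max_left _ _) (Real.exp_pos _).le
    _ ≤ max C 0 * 1 := mul_le_mul_of_nonneg_left
        (Real.exp_le_one_iff.2 (by nlinarith [abs_nonneg t])) (le_max_right _ _)
    _ = max C 0 := mul_one _

/-! ## The inner probe `Φθ` is a window test -/

section Probe

variable {a : ℝ} {θ : ℝ → ℝ}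

/-- `Φθ` is a Weil test function when `θ` is smooth and vanishes for `|t| ≥ a`. -/
theorem ic_isWeilTest_probe (hθ : ContDiff ℝ (⊤ : ℕ∞) θ) (hθ0 : ∀ t, a ≤ |t| → θ t = 0) :
    IsWeilTest fun t : ℝ => ((weilThetaPhi t * θ t : ℝ) : ℂ) := by
  constructor
  · have h1 : ContDiff ℝ (⊤ : ℕ∞) fun t : ℝ => weilThetaPhi t * θ t := contDiff_weilThetaPhi.mul hθ
    exact ofRealCLM.contDiff.comp h1
  · refine HasCompactSupport.of_support_subset_isCompact (isCompact_Icc (a := -a) (b := a))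
      fun t ht => ?_
    by_contra h
    apply ht
    have hta : a ≤ |t| := by
      simp only [mem_Icc, not_and_or, not_le] at h
      rcases h with h | h
      · exact le_of_lt (by linarith [neg_abs_le t])
      · exact le_of_lt (h.trans_le (le_abs_self t))
    simp [hθ0 t hta]

/-- `tsupport (Φθ) ⊆ [-a, a]`. -/
theorem ic_tsupport_probe_subset (hθ0 : ∀ t, a ≤ |t| → θ t = 0) :
    tsupport (fun t : ℝ => ((weilThetaPhi t * θ t : ℝ) : ℂ)) ⊆ Icc (-a) a := by
  refine closure_minimal (fun t ht => ?_) isClosed_Icc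
  by_contra h
  apply ht
  have hta : a ≤ |t| := by
    simp only [mem_Icc, not_and_or, not_le] at h
    rcases h with h | h
    · exact le_of_lt (by linarith [neg_abs_le t])
    · exact le_of_lt (h.trans_le (le_abs_self t))
  simp [hθ0 t hta]

end Probe

/-! ## The polar weight is continuous from the left -/

/-- Left-continuity of the polar weight along `a - η_m`, `η_m → 0`. -/
theorem ic_tendsto_polarWeight {a : ℝ} {η : ℕ → ℝ} (hη : Tendsto η atTop (𝓝 0)) :
    Tendsto (fun m => groundThetaPolarWeight (a - η m)) atTop (𝓝 (groundThetaPolarWeight a)) := by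
  set F : ℝ → ℝ := fun s => weilThetaPhi s * (2 * Real.cosh (s / 2)) with hF
  have hFi : Integrable F := leakSign_integrable_phi_mul_two_cosh
  have hsub : ∀ b : ℝ, groundThetaPolarWeight b = groundThetaPolarWeight a - ∫ x in a..b, F x := by
    intro b
    have h := intervalIntegral.integral_Ioi_sub_Ioi' (f := F) (a := a) (b := b) (μ := volume)
      hFi.integrableOn hFi.integrableOn
    rw [groundThetaPolarWeight_def, groundThetaPolarWeight_def]
    linarith
  have hcont : Continuous fun b => ∫ x in a..b, F x :=
    intervalIntegral.continuous_primitive (fun _ _ => hFi.intervalIntegrable) a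
  have hten : Tendsto (fun m => a - η m) atTop (𝓝 a) := by
    simpa using (tendsto_const_nhds (x := a)).sub hη
  have h2 : Tendsto (fun m => ∫ x in a..(a - η m), F x) atTop (𝓝 (∫ x in a..a, F x)) :=
    (hcont.tendsto a).comp hten
  rw [intervalIntegral.integral_same] at h2
  have h3 := (tendsto_const_nhds (x := groundThetaPolarWeight a)).sub h2
  rw [sub_zero] at h3
  exact h3.congr fun m => (hsub _).symm

/-! ## The polar leakage of the collar kernel -/

/-- `∫ Φ(1-θ)cosh(t/2) ≤ ϖ_{a-η}` when `1 - θ` vanishes on `[-(a-η), a-η]` and `0 ≤ θ ≤ 1`. -/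
theorem ic_collar_cosh_le {b : ℝ} {θ : ℝ → ℝ}
    (hθ1 : ∀ t, |t| ≤ b → θ t = 1) (hθ01 : ∀ t, 0 ≤ θ t ∧ θ t ≤ 1) :
    ∫ t, weilThetaPhi t * (1 - θ t) * Real.cosh (t / 2) ≤ groundThetaPolarWeight b := by
  set G : ℝ → ℝ := fun t => weilThetaPhi t * Real.cosh (t / 2) with hG
  have hGi : Integrable G := by
    have h := leakSign_integrable_phi_mul_two_cosh.div_const 2
    refine h.congr (ae_of_all _ fun t => ?_)
    simp only [hG]
    ring
  have hGI : Integrable ((Ioi b).indicator G) := hGi.indicator measurableSet_Ioi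
  have hGI' : Integrable fun t => (Ioi b).indicator G (-t) := hGI.comp_neg
  have hG0 : ∀ t, 0 ≤ G t := fun t => mul_nonneg (weilThetaPhi_pos t).le (Real.cosh_pos _).le
  have hGe : ∀ t, G (-t) = G t := fun t => by simp only [hG, weilThetaPhi_neg, neg_div, Real.cosh_neg]
  have hInn : ∀ x, 0 ≤ (Ioi b).indicator G x := fun x => Set.indicator_nonneg (fun y _ => hG0 y) x
  -- pointwise domination by the two half-line pieces
  have hpt : ∀ t, weilThetaPhi t * (1 - θ t) * Real.cosh (t / 2) ≤
      (Ioi b).indicator G t + (Ioi b).indicator G (-t) := by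
    intro t
    by_cases ht : |t| ≤ b
    · rw [hθ1 t ht, sub_self, mul_zero, zero_mul]
      exact add_nonneg (hInn _) (hInn _)
    · have hle : weilThetaPhi t * (1 - θ t) * Real.cosh (t / 2) ≤ G t := by
        have h1 : 1 - θ t ≤ 1 := by linarith [(hθ01 t).1]
        have h2 : 0 ≤ 1 - θ t := by linarith [(hθ01 t).2]
        calc weilThetaPhi t * (1 - θ t) * Real.cosh (t / 2)
            ≤ weilThetaPhi t * 1 * Real.cosh (t / 2) :=
              mul_le_mul_of_nonneg_right (mul_le_mul_of_nonneg_left h1 (weilThetaPhi_pos t).le)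
                (Real.cosh_pos _).le
          _ = G t := by simp only [hG, mul_one]
      rw [not_le] at ht
      rcases lt_or_ge b t with h | h
      · rw [indicator_of_mem (show t ∈ Ioi b from h)]
        linarith [hInn (-t), hG0 t]
      · have hneg : -t ∈ Ioi b := by
          have : b < -t := by
            rcases abs_cases t with ⟨h1, _⟩ | ⟨h1, _⟩ <;> linarith
          exact this
        rw [indicator_of_mem hneg, hGe]
        linarith [hInn t, hG0 t]
  have hsum : ∫ t, ((Ioi b).indicator G t + (Ioi b).indicator G (-t)) = groundThetaPolarWeight b := by
    rw [integral_add hGI hGI', integral_neg_eq_self (fun t => (Ioi b).indicator G t) volume,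
      integral_indicator measurableSet_Ioi, groundThetaPolarWeight_def, ← two_mul, ← integral_const_mul]
    refine setIntegral_congr_fun measurableSet_Ioi fun t _ => ?_
    simp only [hG]
    ring
  rw [← hsum]
  -- the left integrand need not be shown integrable: if it is not, its integral is `0 ≤ RHS`
  by_cases hint : Integrable fun t => weilThetaPhi t * (1 - θ t) * Real.cosh (t / 2)
  · exact integral_mono hint (hGI.add hGI') hpt
  · rw [integral_undef hint]
    exact integral_nonneg fun t => add_nonneg (hInn _) (hInn _)

/-! ## The collar mass: `∫ v κ_η ≤ 2Φ(0) √η` -/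

/-- AM–GM bound for the collar mass of an `L²`-subnormalised `v ≥ 0` vanishing off `(-a, a)`:
`∫ v Φ (1 - θ) ≤ 2 Φ(0) √η` when `1 - θ` vanishes on `[-(a-η), a-η]`, `0 ≤ θ ≤ 1`. -/
theorem ic_collar_mass_le {a η : ℝ} (hη : 0 < η) {v θ : ℝ → ℝ}
    (hv0 : ∀ t, 0 ≤ v t) (hvs : ∀ t, t ∉ Ioo (-a) a → v t = 0) (hv2 : Integrable fun t => v t ^ 2)
    (hv21 : ∫ t, v t ^ 2 ≤ 1) (hθ1 : ∀ t, |t| ≤ a - η → θ t = 1) (hθ01 : ∀ t, 0 ≤ θ t ∧ θ t ≤ 1) :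
    ∫ s, v s * (weilThetaPhi s * (1 - θ s)) ≤ 2 * weilThetaPhi 0 * Real.sqrt η := by
  set E : Set ℝ := Ioo (-a) (-(a - η)) ∪ Ioo (a - η) a with hE
  have hEm : MeasurableSet E := measurableSet_Ioo.union measurableSet_Ioo
  have hlam0 : 0 < Real.sqrt η := Real.sqrt_pos.2 hη
  -- pointwise AM-GM: v Φ (1-θ) ≤ Φ(0) (√η v² + (1/(4 √η)) 1_E)
  have hpt : ∀ s, v s * (weilThetaPhi s * (1 - θ s)) ≤
      weilThetaPhi 0 * (Real.sqrt η * v s ^ 2 + (1 / (4 * Real.sqrt η)) * E.indicator (fun _ => (1 : ℝ)) s) := by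
    intro s
    have hΦ := weilThetaPhi_pos s
    have hΦ0 := gbf_weilThetaPhi_le_zero_val s
    by_cases hs : |s| ≤ a - η
    · rw [hθ1 s hs, sub_self, mul_zero, mul_zero]
      exact mul_nonneg (weilThetaPhi_pos 0).le (add_nonneg (mul_nonneg hlam0.le (sq_nonneg _))
        (mul_nonneg (by positivity) (indicator_nonneg (fun _ _ => zero_le_one) _)))
    · by_cases hs' : s ∈ Ioo (-a) a
      · have hsE : s ∈ E := by
          rw [not_le] at hs
          rcases abs_cases s with ⟨h1, _⟩ | ⟨h1, _⟩
          · right; exact ⟨by linarith, hs'.2⟩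
          · left; exact ⟨hs'.1, by linarith⟩
        rw [indicator_of_mem hsE, mul_one]
        have amgm : v s ≤ Real.sqrt η * v s ^ 2 + 1 / (4 * Real.sqrt η) := by
          have h : 0 ≤ Real.sqrt η * (v s - 1 / (2 * Real.sqrt η)) ^ 2 :=
            mul_nonneg hlam0.le (sq_nonneg _)
          have e : Real.sqrt η * (v s - 1 / (2 * Real.sqrt η)) ^ 2 =
              Real.sqrt η * v s ^ 2 - v s + 1 / (4 * Real.sqrt η) := by
            field_simp
            ring
          linarith
        have h1 : weilThetaPhi s * (1 - θ s) ≤ weilThetaPhi 0 := by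
          calc weilThetaPhi s * (1 - θ s) ≤ weilThetaPhi s * 1 :=
                mul_le_mul_of_nonneg_left (by linarith [(hθ01 s).1]) hΦ.le
            _ ≤ weilThetaPhi 0 := by rw [mul_one]; exact hΦ0
        calc v s * (weilThetaPhi s * (1 - θ s)) ≤ v s * weilThetaPhi 0 :=
              mul_le_mul_of_nonneg_left h1 (hv0 s)
          _ = weilThetaPhi 0 * v s := mul_comm _ _
          _ ≤ weilThetaPhi 0 * (Real.sqrt η * v s ^ 2 + 1 / (4 * Real.sqrt η)) :=
              mul_le_mul_of_nonneg_left amgm (weilThetaPhi_pos 0).le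
      · rw [hvs s hs', zero_mul]
        exact mul_nonneg (weilThetaPhi_pos 0).le (add_nonneg (mul_nonneg hlam0.le (sq_nonneg _))
          (mul_nonneg (by positivity) (indicator_nonneg (fun _ _ => zero_le_one) _)))
  have hEvol : (volume : Measure ℝ) E ≤ ENNReal.ofReal (2 * η) := by
    calc (volume : Measure ℝ) E ≤ volume (Ioo (-a) (-(a - η))) + volume (Ioo (a - η) a) :=
          measure_union_le _ _
      _ = ENNReal.ofReal (2 * η) := by
          rw [Real.volume_Ioo, Real.volume_Ioo, ← ENNReal.ofReal_add (by linarith) (by linarith)]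
          congr 1; ring
  have hEfin : (volume : Measure ℝ) E < ⊤ := hEvol.trans_lt ENNReal.ofReal_lt_top
  have hIi : Integrable (E.indicator fun _ => (1 : ℝ)) :=
    (integrable_indicator_iff hEm).2 (integrableOn_const hEfin.ne)
  have hI1 : ∫ s, E.indicator (fun _ => (1 : ℝ)) s ≤ 2 * η := by
    rw [integral_indicator hEm, setIntegral_const, smul_eq_mul, mul_one]
    have := ENNReal.toReal_mono ENNReal.ofReal_ne_top hEvol
    rwa [ENNReal.toReal_ofReal (by linarith)] at this
  have hrhs : Integrable fun s => weilThetaPhi 0 * (Real.sqrt η * v s ^ 2 + (1 / (4 * Real.sqrt η)) *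
      E.indicator (fun _ => (1 : ℝ)) s) := ((hv2.const_mul (Real.sqrt η)).add (hIi.const_mul _)).const_mul _
  have step1 : ∫ s, v s * (weilThetaPhi s * (1 - θ s)) ≤
      weilThetaPhi 0 * (Real.sqrt η * (∫ s, v s ^ 2) +
        (1 / (4 * Real.sqrt η)) * ∫ s, E.indicator (fun _ => (1 : ℝ)) s) := by
    have h := integral_mono_of_nonneg (ae_of_all _ fun s => mul_nonneg (hv0 s)
      (mul_nonneg (weilThetaPhi_pos s).le (by linarith [(hθ01 s).2]))) hrhs (ae_of_all _ hpt)
    refine h.trans (le_of_eq ?_)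
    rw [integral_const_mul, integral_add (hv2.const_mul (Real.sqrt η)) (hIi.const_mul _), integral_const_mul,
      integral_const_mul]
  have step2 : Real.sqrt η * (∫ s, v s ^ 2) + (1 / (4 * Real.sqrt η)) * ∫ s, E.indicator (fun _ => (1 : ℝ)) s ≤
      Real.sqrt η + (1 / (4 * Real.sqrt η)) * (2 * η) := by
    have h1 : Real.sqrt η * (∫ s, v s ^ 2) ≤ Real.sqrt η * 1 := mul_le_mul_of_nonneg_left hv21 hlam0.le
    have h2 : (1 / (4 * Real.sqrt η)) * ∫ s, E.indicator (fun _ => (1 : ℝ)) s ≤ (1 / (4 * Real.sqrt η)) * (2 * η) :=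
      mul_le_mul_of_nonneg_left hI1 (by positivity)
    linarith
  have step3 : Real.sqrt η + (1 / (4 * Real.sqrt η)) * (2 * η) = (3 / 2) * Real.sqrt η := by
    have h1 : (1 / (4 * Real.sqrt η)) * (2 * η) = Real.sqrt η / 2 := by
      calc (1 / (4 * Real.sqrt η)) * (2 * η) = (η / Real.sqrt η) / 2 := by ring
        _ = Real.sqrt η / 2 := by rw [Real.div_sqrt]
    rw [h1]; ring
  calc ∫ s, v s * (weilThetaPhi s * (1 - θ s))
      ≤ weilThetaPhi 0 * (Real.sqrt η * (∫ s, v s ^ 2) +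
          (1 / (4 * Real.sqrt η)) * ∫ s, E.indicator (fun _ => (1 : ℝ)) s) := step1
    _ ≤ weilThetaPhi 0 * ((3 / 2) * Real.sqrt η) := by
        rw [← step3]; exact mul_le_mul_of_nonneg_left step2 (weilThetaPhi_pos 0).le
    _ ≤ 2 * weilThetaPhi 0 * Real.sqrt η := by
        nlinarith [weilThetaPhi_pos 0, Real.sqrt_nonneg η]

end Summit.RiemannHypothesis.RiemannHypothesis.Theorems.GroundBartaFloor

end
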